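import Mathlib
import HarnessLib
import Summits.ValiantsHypothesis.ValiantsHypothesis.Theses.MonotoneRestoration
import Literature.Computability.AlgebraicComplexity.SymmetricDenseSubtractionSymmetry

/-! # Route MonotoneRestoration — support `DenseSubtraction` (stmt-ValiantsHypothesis-16195)

Symmetric subtraction of the dense part: a square-symmetric (`Γ = S_n`, diagonal action on
`Fin n × Fin n`) labelled arithmetic circuit `C` over `ℂ` computing `(1 + Σ_ij x_ij)^d + ε·q`
(`ε ≠ 0` real) yields a square-symmetric circuit computing `q` with at most
`|C| + d + n² + 16` gates.

Proof: this is the instance `K = ℂ`, `X = Fin n × Fin n`, `Γ = Equiv.Perm (Fin n)` of the tree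
lemma `LabelledArithCircuit.IsSymmetric.exists_sub_dense`
(`Literature/Computability/AlgebraicComplexity/SymmetricDenseSubtractionSymmetry.lean`, the
symmetric-circuit form of the remark after Hrubeš 2020, Thm. 1), whose size bound
`|C| + |X| + d + 7 = |C| + n² + d + 7` is within budget.
-/

noncomputable section

-- `Summit.ValiantsHypothesis.ValiantsHypothesis.…` is the tree's mandated namespace (Sub = Summit).
set_option linter.dupNamespace false

namespace Summit.ValiantsHypothesis.ValiantsHypothesis.Theorems

open Literature.Computability.AlgebraicComplexity

/-- **Dense subtraction** (route MonotoneRestoration, support item stmt-ValiantsHypothesis-16195):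
from a square-symmetric circuit over `ℂ` computing `(1 + Σ_ij x_ij)^d + ε·q` with `ε ≠ 0` real one
gets a square-symmetric circuit computing `q` with at most `|C| + d + n² + 16` gates. Instance of
`LabelledArithCircuit.IsSymmetric.exists_sub_dense`. -/
theorem denseSubtraction_proof :
    Summit.ValiantsHypothesis.ValiantsHypothesis.Theses.MonotoneRestoration.DenseSubtraction := by
  intro n d ε hε q G _ C hsym heval
  have he : (ε : ℂ) ≠ 0 := Complex.ofReal_ne_zero.mpr hε
  obtain ⟨G', hG', C', hC'sym, hC'eval, hcard⟩ := hsym.exists_sub_dense d he q heval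
  refine ⟨G', hG', C', hC'sym, hC'eval, ?_⟩
  have hX : Fintype.card (Fin n × Fin n) = n * n := by
    rw [Fintype.card_prod, Fintype.card_fin]
  omega

end Summit.ValiantsHypothesis.ValiantsHypothesis.Theorems

end
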